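import Literature.Computability.FineGrained.SerfRedPresent
import Literature.Computability.Cryptography.WordRAMSubrunLoop
import HarnessLib

/-!
# Sparsification as a word-RAM SERF reduction: the driver program and its certificate

Infrastructure for the discharge of
`Literature.Computability.FineGrained.kSATInRAMTime_of_sparseKSATInRAMTime_serf` (`OVFromSETH.lean`;
Impagliazzo–Paturi–Zane, JCSS 63 (2001), Thm. 1, Cor. 1–2: `k`-SAT with parameter `n` SERF-reduces to
sparse `k`-SAT), completing `SerfRedParser.lean` / `SerfRedPresent.lean`. The **driver**
`SerfRed.driver Mt k k' M` is the word-RAM program of the reduction: a build phase `SerfRed.pre`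
(relocate the input, transcode it with `KSatTranscoder.transcode`, simulate the multi-stack sparsifier
`Mt` with `TM2Emu.simProgram`, set up the stream pointers of its output stack, the word size by a
doubling loop, the emulator's regions `Bv = 2^{W-1}`, `Sv = Bv + 2^{W-2}`, and clear the scratch
registers), then the loop `SProg.withSubrunLoop` of `…Cryptography.WordRAMSubrunLoop` with body
`SerfRed.leafBody` (parse and present one leaf), one emulated run of the sparse-`k`-SAT program `M`,
and `SerfRed.post`, and the exit `SerfRed.fin`.

* `pre_exec` — the build phase ends, within `preTime + 4 W` steps, in the closed-form store
  `merge (preRegs …) Hf` whose data streams the codes of the sparsifier's output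
  (`streamAt_dataMem`), is `0` from `2^{W-1}` on (`dataMem_eq_zero_of_le`) and word-bounded
  (`dataMem_le`);
* `LoopInv` and **`leaf_step`** — the `hbody` clause of `outputsWithin_withSubrunLoop_sum`: from the
  invariant after `i` leaves the body presents `encodeCNFWords (pres k n Ψ[i].clauses)` (an
  instance of `kSATProblem k` of density `max (C_s + 1) 2`: `isWidthLE_pres`, `nodup_pres`,
  `numClauses_pres_le`, the last using `length_le_two_mul_numVars` for `k ≤ 1`), the program `M`
  halts on it with the leaf's answer (`satisfiable_pres_iff`), and `post` re-establishes the
  invariant (`accOf_succ`); `loopInv_zero`, `loop_exit`;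
* **`driver_outputsWithin`** — the driver outputs `[1]`/`[0]` according to the satisfiability of
  `φ` within `preTime + 4W + 19 · |output| + N · (7Y + 4W + 124 + 38 · nmax) + 4` steps, under the
  contracts of the sparsifier and of `M` and the word-size conditions (discharged for
  `W = K (n + width)` in `OVFromSETHProofs.lean`).

[folklore] engineering around [cite: ImpagliazzoPaturiZaneJCSS2001, Corollary 1 and Corollary 2].
-/

namespace Literature.Computability.FineGrained.SerfRed

open _root_.Computability Turing Cryptography Cryptography.WordRAM Cryptography.WordRAM.SProg Complexity
  KSatTranscoder

attribute [local instance] Turing.FinTM2.kFin Turing.FinTM2.ΛFin Turing.FinTM2.σFin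
  Turing.FinTM2.Γk₀Fin

open SparseSatBridge (padClause)

/-! ### The codes of the sparsifier machine -/

section machine

variable (Mt : TM2ComputableAux Γ' Γ')

/-- The code of an input symbol of the machine. [folklore] -/
noncomputable def codeI (γ : Γ') : ℕ := (TM2Emu.enc Mt.tm).code Mt.tm.k₀ (Mt.inputAlphabet.symm γ)

/-- The five input-symbol codes handed to the forward transcoder. [folklore] -/
noncomputable def icodes : KSatTranscoder.Codes :=
  ⟨codeI Mt (.bit false), codeI Mt (.bit true), codeI Mt .bra, codeI Mt .ket, codeI Mt .comma⟩

/-- The code of an output symbol of the machine. [folklore] -/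
noncomputable def codeO (γ : Γ') : ℕ := (TM2Emu.enc Mt.tm).code Mt.tm.k₁ (Mt.outputAlphabet.symm γ)

/-- The six output-symbol codes handed to the parser. [folklore] -/
noncomputable def pcodes : PCodes :=
  ⟨codeO Mt .blank, codeO Mt (.bit false), codeO Mt (.bit true), codeO Mt .bra, codeO Mt .ket, codeO Mt .comma⟩

/-- The parser's code map is the machine's output numbering. [folklore] -/
theorem pcodes_cd (γ : Γ') : (pcodes Mt).cd γ = codeO Mt γ := by
  rcases γ with _ | ⟨_ | _⟩ | _ | _ | _ <;> rfl

/-- The machine's input on `φ`: its string encoding of `toKCNF k φ`, in the machine's alphabet. [folklore] -/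
def inp {k : ℕ} (φ : CNF ℕ) (hw : φ.IsWidthLE k) : List (Mt.tm.Γ Mt.tm.k₀) :=
  (KCNF.encode (toKCNF k φ hw)).map Mt.inputAlphabet.symm

/-- The forward transcoder produces exactly the codes of the machine's input (as
`SETHBridge.cnfCodes_eq_map_inp`, for a machine with output alphabet `Γ'`). [folklore] -/
theorem cnfCodes_eq_map_inp {k : ℕ} (φ : CNF ℕ) (hw : φ.IsWidthLE k) :
    (icodes Mt).cnfCodes φ = (inp Mt φ hw).map ((TM2Emu.enc Mt.tm).code Mt.tm.k₀) := by
  have hbit : ∀ b, (icodes Mt).bit b = codeI Mt (.bit b) := fun b => by cases b <;> rfl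
  have hbits : ∀ v, (icodes Mt).bitsCode v = ((encodeNat v).map Γ'.bit).map (codeI Mt) := fun v => by
    simp [KSatTranscoder.Codes.bitsCode, encodeNat_eq_natBits, hbit]
  have hlit : ∀ l : ℕ × Bool, (icodes Mt).litCodes l = (KCNF.encodeLiteral l).map (codeI Mt) := fun l => by
    simp [KSatTranscoder.Codes.litCodes, KCNF.encodeLiteral, hbits, hbit]; rfl
  have hcl : ∀ c : List (ℕ × Bool), (icodes Mt).clauseCodes c = (KCNF.encodeClause c).map (codeI Mt) :=
    fun c => by
    simp only [KSatTranscoder.Codes.clauseCodes, KCNF.encodeClause, List.map_cons, List.map_append, List.map_flatMap,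
      List.map_nil]
    rw [show (icodes Mt).bra = codeI Mt .bra from rfl, show (icodes Mt).ket = codeI Mt .ket from rfl]
    congr 2
    exact List.flatMap_congr fun l _ => hlit l
  simp only [inp, List.map_map, KSatTranscoder.Codes.cnfCodes, KCNF.encode, toKCNF, List.map_append, List.map_cons,
    List.map_flatMap, hbits]
  rw [show (icodes Mt).comma = codeI Mt .comma from rfl]
  congr 2
  · exact List.flatMap_congr fun c _ => (hcl c).trans (by rfl)

/-- The input codes are codes of input symbols, hence at most `γ`. [folklore] -/
theorem icodes_sup_le : (icodes Mt).sup ≤ (TM2Emu.enc Mt.tm).γ := by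
  have h : ∀ γ, codeI Mt γ ≤ (TM2Emu.enc Mt.tm).γ := fun γ =>
    (TM2Emu.enc_good Mt.tm).code_le _ _ (TM2Emu.mem_alphabet_k₀ Mt.tm _)
  simp only [icodes, KSatTranscoder.Codes.sup]
  have := h (.bit false); have := h (.bit true); have := h .bra; have := h .ket; have := h .comma
  omega

/-- Every output code is at most `γ + 1` (symbols outside the working alphabet all receive the code
`|alphabet| + 1`). [folklore] -/
theorem codeO_le_succ (γ : Γ') : codeO Mt γ ≤ (TM2Emu.enc Mt.tm).γ + 1 := by
  classical
  unfold codeO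
  show (TM2Emu.alphaList Mt.tm Mt.tm.k₁).idxOf _ + 1 ≤ (Finset.univ : Finset Mt.tm.K).sup (fun k => (TM2Emu.alphaList Mt.tm k).length) + 1
  have h1 := List.idxOf_le_length (a := Mt.outputAlphabet.symm γ) (l := TM2Emu.alphaList Mt.tm Mt.tm.k₁)
  have h2 : (TM2Emu.alphaList Mt.tm Mt.tm.k₁).length ≤ (Finset.univ : Finset Mt.tm.K).sup fun k => (TM2Emu.alphaList Mt.tm k).length :=
    Finset.le_sup (f := fun k => (TM2Emu.alphaList Mt.tm k).length) (Finset.mem_univ _)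
  omega

/-- The parser's codes are at most `γ + 1`. [folklore] -/
theorem pcodes_sup_le : (pcodes Mt).sup ≤ (TM2Emu.enc Mt.tm).γ + 1 := by
  have h := codeO_le_succ Mt
  simp only [pcodes, PCodes.sup]
  have := h .blank; have := h (.bit false); have := h (.bit true); have := h .bra; have := h .ket; have := h .comma
  omega

/-- Output codes of symbols of the working alphabet are at most `γ`. [folklore] -/
theorem codeO_le {γ : Γ'} (h : Mt.outputAlphabet.symm γ ∈ TM2Emu.alphabet Mt.tm Mt.tm.k₁) :
    codeO Mt γ ≤ (TM2Emu.enc Mt.tm).γ :=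
  (TM2Emu.enc_good Mt.tm).code_le _ _ h

/-! ### The program -/

/-- After the transcoder: hand its output to the simulator (`r4 := Q`, `r10 := |string|`,
`r11 := Q`), recover `D + 1 = (r20 - r21 - 101) / 2 + 101` and stash `n = mem[D + 1]` in the data
cell `100` (which the simulation leaves alone). [folklore] -/
def glueOps : List OpSpec :=
  [(.add, .dir 4, .dir 20, .imm 0), (.add, .dir 10, .dir 21, .imm 0), (.add, .dir 11, .dir 20, .imm 0),
   (.sub, .dir 12, .dir 20, .dir 21), (.sub, .dir 12, .dir 12, .imm 101), (.div, .dir 12, .dir 12, .imm 2),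
   (.add, .dir 12, .dir 12, .imm 101), (.div, .dir 100, .ind 12, .imm 1)]

/-- After the simulation (`r4 = Q`): `N0 := mem[100]`, `P := mem[Q + i₁]` (the top of the output
stack), `BOT := Q + κ + i₁`, `FLAG := (BOT < P)`, `ACC := 0`, and the initial values of the
word-size loop. [folklore] -/
def setupOps (κ i₁ : ℕ) : List OpSpec :=
  [(.div, r 24, .dir 100, im 1), (.add, r 50, r 4, im i₁), (.div, r 20, pt 50, im 1), (.add, r 21, r 4, im (κ + i₁)),
   (.lt, r 22, r 21, r 20), (.band, r 25, im 0, im 0), (.band, r 61, im 1, im 1), (.band, r 60, im 0, im 0)]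

/-- The word-size loop: `r61` doubles until it wraps to `0`; `r60` counts the rounds, ending at `W`.
[folklore] -/
def wLoop : SProg := whilenz (r 61) (block [(.add, r 61, r 61, r 61), (.add, r 60, r 60, im 1)])

/-- The emulator's regions from the word size: `Bv := 2^(W-1)`, `Sv := Bv + 2^(W-2)`, `G := 0`.
[folklore] -/
def regionOps : List OpSpec :=
  [(.sub, r 50, r 60, im 1), (.shl, r 30, im 1, r 50), (.sub, r 50, r 60, im 2), (.shl, r 51, im 1, r 50),
   (.add, r 31, r 30, r 51), (.band, r 32, im 0, im 0)]

/-- The registers kept after the build phase. [folklore] -/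
def keepRegs : List ℕ := [20, 21, 22, 24, 25, 30, 31, 32, 60]

/-- Clear every other register, so that the store entering the loop is known in closed form.
[folklore] -/
def clearOps : List OpSpec :=
  ((List.range 100).filter fun i => i ∉ keepRegs).map fun i => (.band, r i, im 0, im 0)

/-- **The build phase of the driver**: relocate and transcode the input, simulate the sparsifier,
set up the stream pointers, the word size and the emulator's regions, clear the scratch registers.
[folklore] -/
noncomputable def pre : SProg :=
  seqs [relocate, KSatTranscoder.transcode (icodes Mt), block glueOps, TM2Emu.simProgram Mt.tm,
    block (setupOps (TM2Emu.enc Mt.tm).κ ((TM2Emu.enc Mt.tm).ι Mt.tm.k₁)), wLoop, block regionOps, block clearOps]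

/-- `pre` is query-free. [folklore] -/
theorem pre_queryFree : (pre Mt).QueryFree :=
  seqs_queryFree fun s hs => by
    simp only [List.mem_cons, List.not_mem_nil, or_false] at hs
    rcases hs with rfl | rfl | rfl | rfl | rfl | rfl | rfl | rfl
    · exact relocate_queryFree
    · exact KSatTranscoder.transcode_queryFree _
    · exact block_queryFree _
    · exact TM2Emu.simProgram_queryFree _
    · exact block_queryFree _
    · exact ⟨trivial, block_queryFree _⟩
    · exact block_queryFree _
    · exact block_queryFree _

/-- **The driver** of the SERF reduction: the build phase, then one emulated run of the sparse
`k`-SAT program `M` (word-size constant `k'`) per leaf of the sparsifier's output, then the answer.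
[cite: ImpagliazzoPaturiZaneJCSS2001, Cor. 1 and Cor. 2 (the SERF reduction)] -/
noncomputable def driver (k k' : ℕ) (M : Program) : Program :=
  withSubrunLoop (pre Mt) 22 (leafBody (pcodes Mt) (TM2Emu.enc Mt.tm).κ k k') lay M post fin

/-- The driver is deterministic. [folklore] -/
theorem driver_isDeterministic (k k' : ℕ) (M : Program) : (driver Mt k k' M).IsDeterministic :=
  withSubrunLoop_isDeterministic _ _ _ _ _ _ _

/-- The driver is oracle-free. [folklore] -/
theorem driver_isOracleFree (k k' : ℕ) (M : Program) : (driver Mt k k' M).IsOracleFree :=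
  withSubrunLoop_isOracleFree (pre_queryFree Mt) (leafBody_queryFree _ _ _ _) post_queryFree fin_queryFree _ _ _

end machine

/-! ### Stack streams and the data of the simulation -/

/-- A stack's cells, read downwards from its top, stream its code list. [folklore] -/
theorem streamAt_of_stackCell {H : ℕ → ℕ} {BOT κ : ℕ} :
    ∀ (l : List ℕ), (∀ j, 1 ≤ j → j ≤ l.length → H (BOT + κ * j) = stackCell l j) → StreamAt H BOT κ l.length l
  | [], _ => trivial
  | c :: l, h => by
    refine ⟨by simp, ?_, ?_⟩
    · rw [h _ (by simp) (by simp), List.length_cons, stackCell_cons, if_pos rfl]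
    · rw [List.length_cons, Nat.add_sub_cancel]
      exact streamAt_of_stackCell l fun j hj hjl => by
        rw [h j hj (by simp; omega), stackCell_cons, if_neg (by omega)]

/-- **The output stack of the simulated machine streams the output codes.** [folklore] -/
theorem streamAt_dataMem (G : ℕ → ℕ) (Q : ℕ) {κ i : ℕ} (hi : i < κ) (S : ℕ → List ℕ) :
    StreamAt (dataMem G Q κ S) (Q + κ + i) κ (S i).length (S i) :=
  streamAt_of_stackCell (S i) fun j _ _ => by
    rw [show Q + κ + i + κ * j = cellAddr Q κ i j by unfold cellAddr; ring, dataMem_cellAddr G Q S hi]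

/-- Above all stacks the data memory is `0`. [folklore] -/
theorem dataMem_eq_zero_of_le (G : ℕ → ℕ) (Q : ℕ) {κ Hb : ℕ} (hκ : 0 < κ) (S : ℕ → List ℕ)
    (hS : ∀ i, (S i).length ≤ Hb) {a : ℕ} (ha : cellAddr Q κ 0 (Hb + 1) ≤ a) : dataMem G Q κ S a = 0 := by
  unfold cellAddr at ha
  have hk1 : κ * 1 ≤ κ * (Hb + 1) := Nat.mul_le_mul_left κ (by omega)
  unfold dataMem
  rw [if_neg (by omega), if_neg (by omega)]
  apply stackCell_of_length_lt
  refine lt_of_le_of_lt (hS _) (Nat.lt_of_lt_of_le (Nat.lt_add_one Hb) ?_)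
  rw [Nat.le_div_iff_mul_le hκ, Nat.mul_comm]
  omega

/-- Every value of the data memory is a frozen value, a cell address below the top, or a code. [folklore] -/
theorem dataMem_le (G : ℕ → ℕ) (Q : ℕ) {κ Hb V : ℕ} (S : ℕ → List ℕ) (hS : ∀ i, (S i).length ≤ Hb)
    (hG : ∀ a, a < Q → G a ≤ V) (hcodes : ∀ i, ∀ c ∈ S i, c ≤ V) (hA : cellAddr Q κ κ Hb ≤ V) (a : ℕ) :
    dataMem G Q κ S a ≤ V := by
  unfold dataMem
  split_ifs with h1 h2
  · exact hG a h1
  · refine le_trans ?_ hA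
    have := Nat.mul_le_mul_left κ (hS (a - Q))
    unfold cellAddr; omega
  · unfold stackCell
    split_ifs
    · exact Nat.zero_le _
    · rw [List.getD_eq_getElem?_getD]
      cases h : (S ((a - (Q + κ)) % κ)).reverse[(a - (Q + κ)) / κ - 1]? with
      | none => exact Nat.zero_le _
      | some c => exact hcodes _ c (List.mem_reverse.1 (List.mem_of_getElem? h))

/-! ### Semantics of the build phase -/

section preExec

variable {w : ℕ} (Mt : TM2ComputableAux Γ' Γ')

/-- Clearing registers. [folklore] -/
theorem clear_exec {O : List ℕ → List ℕ} {H : ℕ → ℕ} (qs : List (List ℕ)) :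
    ∀ (l : List ℕ) (R : ℕ → ℕ), (∀ i ∈ l, i < 100) →
      Exec w O (block (l.map fun i => (.band, r i, im 0, im 0))) ⟨merge R H, qs⟩
        ⟨merge (fun a => if a ∈ l then 0 else R a) H, qs⟩ l.length
  | [], R, _ => by simp only [List.map_nil, List.not_mem_nil, if_false, List.length_nil]; exact Exec.skip _
  | i :: l, R, hl => by
    have hi : i < 100 := hl i (by simp)
    have h1 : Exec w O (op .band (r i) (im 0) (im 0)) ⟨merge R H, qs⟩ ⟨merge (Function.update R i 0) H, qs⟩ 1 := by
      have := Exec.op_dir (w := w) (O := O) hi .band (im 0) (im 0) R H qs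
      simpa using this
    have h2 := clear_exec (O := O) (H := H) qs l (Function.update R i 0) fun j hj => hl j (by simp [hj])
    have heq : (fun a => if a ∈ l then 0 else Function.update R i 0 a) = fun a => if a ∈ i :: l then 0 else R a := by
      funext a
      by_cases ha : a = i
      · subst ha; simp
      · simp [ha]
    rw [heq] at h2
    simpa [block, List.length_cons, Nat.add_comm] using Exec.seq h1 h2

/-- The registers entering the loop: stream pointer, bottom, flag, `n`, `ACC = 0`, the regions,
generation `0`, the word size; everything else `0`. [folklore] -/
def preRegs (top BOT n Bv Sv W : ℕ) : ℕ → ℕ := fun a =>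
  if a = 20 then top else if a = 21 then BOT else if a = 22 then (if BOT < top then 1 else 0)
  else if a = 24 then n else if a = 30 then Bv else if a = 31 then Sv else if a = 60 then W else 0

/-- **The word-size loop** ends after `W` rounds with `r60 = W`, `r61 = 0` (from round `t < W`,
where `r61 = 2^t`). [folklore] -/
theorem wLoop_exec {O : List ℕ → List ℕ} {H : ℕ → ℕ} (qs : List (List ℕ)) (hw3 : w < 2 ^ w) :
    ∀ (d : ℕ) (R : ℕ → ℕ) (t : ℕ), R 61 = 2 ^ t → R 60 = t → t + d = w → t < w →
      ∃ (R' : ℕ → ℕ) (tm : ℕ), Exec w O wLoop ⟨merge R H, qs⟩ ⟨merge R' H, qs⟩ tm ∧ tm ≤ 4 * d + 1 ∧ R' 60 = w ∧ R' 61 = 0 ∧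
        ∀ a, a ≠ 60 → a ≠ 61 → R' a = R a
  | 0, R, t, _, _, htd, ht => by omega
  | d + 1, R, t, h61, h60, htd, ht => by
    have hne : R 61 ≠ 0 := by rw [h61]; exact (Nat.two_pow_pos t).ne'
    have hA : BinOp.eval w .add (2 ^ t) (2 ^ t) = 2 ^ (t + 1) % 2 ^ w := by
      show (2 ^ t + 2 ^ t) % 2 ^ w = _; rw [← two_mul, ← pow_succ']
    have hB : BinOp.eval w .add t 1 = t + 1 := BinOp.eval_add_of_lt (by omega)
    set R₁ : ℕ → ℕ := Function.update (Function.update R 61 (2 ^ (t + 1) % 2 ^ w)) 60 (t + 1) with hR₁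
    have h1 : Exec w O (block [(.add, r 61, r 61, r 61), (.add, r 60, r 60, im 1)]) ⟨merge R H, qs⟩ ⟨merge R₁ H, qs⟩ 2 := by
      refine Exec.block' _ qs ?_
      simp (disch := first | decide | omega) only [execOps_cons, execOps_nil, execOp, Operand.read,
        Operand.write, merge_apply_of_lt, update_merge_of_lt, Function.update_of_ne, h61, h60, hA, hB, hR₁]
    rcases Nat.lt_or_ge (t + 1) w with hlt | hge
    · have hmod : 2 ^ (t + 1) % 2 ^ w = 2 ^ (t + 1) := Nat.mod_eq_of_lt (Nat.pow_lt_pow_right (by norm_num) hlt)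
      obtain ⟨R', tm, h2, htm, h60', h61', hR'⟩ := wLoop_exec qs hw3 d R₁ (t + 1) (by simp [hR₁, hmod]) (by simp [hR₁])
        (by omega) hlt
      refine ⟨R', 2 + tm + 2, Exec.while_ne (by rw [read_r (by decide)]; exact hne) h1 h2, by omega, h60', h61',
        fun a ha hb => ?_⟩
      rw [hR' a ha hb]; simp [hR₁, ha, hb]
    · have htw : t + 1 = w := by omega
      have hz : R₁ 61 = 0 := by simp [hR₁, htw]
      refine ⟨R₁, 2 + 1 + 2, Exec.while_ne (by rw [read_r (by decide)]; exact hne) h1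
        (Exec.while_zero (by rw [read_r (by decide), hz])), by omega, by simp [hR₁, htw], hz, fun a ha hb => by
          simp [hR₁, ha, hb]⟩


/-- Every cell of the relocated memory is below any common strict bound of the entries that
exceeds `L + 101`. [folklore] -/
theorem relocated_lt (x : List ℕ) {V : ℕ} (hx : ∀ v ∈ x, v < V) (hL : x.length + 100 + 1 < V) (a : ℕ) :
    relocated x a < V := by
  have hget : ∀ i, x.getD i 0 < V := fun i => by
    rw [List.getD_eq_getElem?_getD]
    cases h : x[i]? with
    | none => simp; omega
    | some v => simpa using hx v (List.mem_of_getElem? h)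
  unfold relocated; split_ifs <;> first | omega | exact hget _

/-- Merged memories only depend on the registers below `100`. [folklore] -/
theorem merge_congr {R R' H : ℕ → ℕ} (h : ∀ a, a < 100 → R a = R' a) : merge R H = merge R' H := by
  funext a; unfold merge; split_ifs with ha
  · exact h a ha
  · rfl

/-- The base `Q` of the simulated stacks: after the relocated input and the transcoded string. [folklore] -/
noncomputable def Qof (φ : CNF ℕ) : ℕ := 2 * (encodeCNFWords φ).length + 101 + ((icodes Mt).cnfCodes φ).length

/-- The bottom (dummy) cell of the output stack. [folklore] -/
noncomputable def BOTof (φ : CNF ℕ) : ℕ := Qof Mt φ + (TM2Emu.enc Mt.tm).κ + (TM2Emu.enc Mt.tm).ι Mt.tm.k₁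

/-- The time of the build phase, up to the `4 W + 1` steps of the word-size loop. [folklore] -/
noncomputable def preTime (φ : CNF ℕ) (T' : ℕ) : ℕ :=
  7 * (encodeCNFWords φ).length + KSatTranscoder.transcodeTime φ + TM2Emu.bootCost Mt.tm +
    9 * ((icodes Mt).cnfCodes φ).length + T' * ((TM2Emu.enc Mt.tm).stepCost Mt.tm.m + 2) + 114

/-- **Semantics of the build phase.** If the machine outputs `out` on its input for `φ` within `T'`
steps, then from the initial store of `encodeCNFWords φ` the build phase ends, within
`preTime + 4 W` steps, in the store `merge (preRegs …) Hf` whose data `Hf` streams the output codes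
from the output stack (bottom cell `BOTof`, stride `κ`, height `|out|`), is `0` from `2^(W-1)` on and
bounded by `2^W - 1` everywhere. [folklore] -/
theorem pre_exec {k : ℕ} (φ : CNF ℕ) (hwid : φ.IsWidthLE k) {out : List (Mt.tm.Γ Mt.tm.k₁)} {T' : ℕ}
    (hrun : Nonempty (TM2OutputsInTime Mt.tm (inp Mt φ hwid) (some out) T'))
    (hlen : out.length ≤ TM2Emu.heightBound Mt.tm ((icodes Mt).cnfCodes φ).length T')
    (hw3 : 3 ≤ w) (hwI : inputWidth (encodeCNFWords φ) ≤ w) (hwL : 2 * (encodeCNFWords φ).length + 200 < 2 ^ w)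
    (hw : cellAddr (Qof Mt φ) (TM2Emu.enc Mt.tm).κ (TM2Emu.enc Mt.tm).κ
        (TM2Emu.heightBound Mt.tm ((icodes Mt).cnfCodes φ).length T') + (TM2Emu.enc Mt.tm).κ < 2 ^ (w - 1))
    (hγ : (TM2Emu.enc Mt.tm).γ < 2 ^ w) (hkey : TM2Emu.keyBound Mt.tm < 2 ^ w) :
    ∃ (Hf : ℕ → ℕ) (t : ℕ), Exec w noOracle (pre Mt) ⟨initFun (encodeCNFWords φ), []⟩
        ⟨merge (preRegs (BOTof Mt φ + (TM2Emu.enc Mt.tm).κ * out.length) (BOTof Mt φ) φ.numVars (2 ^ (w - 1))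
          (2 ^ (w - 1) + 2 ^ (w - 2)) w) Hf, []⟩ t ∧
      t ≤ preTime Mt φ T' + 4 * w ∧
      StreamAt Hf (BOTof Mt φ) (TM2Emu.enc Mt.tm).κ out.length (out.map ((TM2Emu.enc Mt.tm).code Mt.tm.k₁)) ∧
      (∀ a, 2 ^ (w - 1) ≤ a → Hf a = 0) ∧ (∀ a, Hf a ≤ 2 ^ w - 1) ∧
      (∀ a ∈ out, a ∈ TM2Emu.alphabet Mt.tm Mt.tm.k₁) ∧
      BOTof Mt φ + (TM2Emu.enc Mt.tm).κ * out.length < 2 ^ (w - 1) := by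
  have hgood : (TM2Emu.enc Mt.tm).Good (TM2Emu.alphabet Mt.tm) := TM2Emu.enc_good Mt.tm
  set E := TM2Emu.enc Mt.tm with hE
  set x := encodeCNFWords φ with hx
  set cds := (icodes Mt).cnfCodes φ with hcds
  set Q := Qof Mt φ with hQ
  have hQdef : Q = 2 * x.length + 101 + cds.length := rfl
  set i₁ := E.ι Mt.tm.k₁ with hi₁
  have hi₁κ : i₁ < E.κ := hgood.ι_lt _
  have hκ : 0 < E.κ := hgood.κ_pos
  have hw1 : 2 ^ (w - 1) < 2 ^ w := Nat.pow_lt_pow_right (by norm_num) (by omega)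
  have hw2 : 2 ^ (w - 1) + 2 ^ (w - 2) < 2 ^ w := by
    have : 2 ^ (w - 2) + 2 ^ (w - 2) = 2 ^ (w - 1) := by rw [← two_mul, ← pow_succ']; congr 1; omega
    have : 2 ^ (w - 1) + 2 ^ (w - 1) = 2 ^ w := by rw [← two_mul, ← pow_succ']; congr 1; omega
    have : 0 < 2 ^ (w - 2) := Nat.two_pow_pos _
    omega
  have hww : w < 2 ^ w := Nat.lt_two_pow_self
  -- sizes
  have hL2 : 2 ≤ x.length := by rw [hx, KSatTranscoder.length_encodeCNFWords]; omega
  have hxw : ∀ v ∈ x, v < 2 ^ w := fun v hv =>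
    lt_of_lt_of_le (lt_two_pow_inputWidth_of_mem _ v hv) (Nat.pow_le_pow_right (by norm_num) hwI)
  have hHb : Q + E.κ + E.κ ≤ cellAddr Q E.κ E.κ (TM2Emu.heightBound Mt.tm cds.length T') := by unfold cellAddr; omega
  have hQw : Q + E.κ + E.κ < 2 ^ (w - 1) := by omega
  -- 1. relocation
  have h1 : Exec w noOracle relocate ⟨initFun x, []⟩ ⟨relocated x, []⟩ (7 * x.length) :=
    relocate_exec (by omega) hxw (by omega) []
  -- 2. transcoding
  have hsup : (icodes Mt).sup < 2 ^ w := lt_of_le_of_lt (icodes_sup_le Mt) hγ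
  obtain ⟨R₁, t₁, h2, ht₁, h20, h21⟩ := KSatTranscoder.transcode_exec (O := noOracle) (icodes Mt) hsup φ hxw
    (by rw [← hx, ← hcds]; omega) hwL []
  rw [← hcds] at h21
  rw [← hx, ← hcds] at h2 h20
  -- 3. glue and stash
  have hn : outMem (relocated x) (2 * x.length + 101) cds (x.length + 101) = φ.numVars := by
    rw [outMem_of_lt _ _ (by omega), show x.length + 101 = x.length + 100 + 1 by omega,
      relocated_base_add x le_rfl (by omega)]
    rw [hx, KSatTranscoder.encodeCNFWords_eq]; rfl
  have hS1 : BinOp.eval w .sub (2 * x.length + 101 + cds.length) cds.length = 2 * x.length + 101 := by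
    rw [BinOp.eval_sub_of_le (by omega) (by omega)]; omega
  have hS2 : BinOp.eval w .sub (2 * x.length + 101) 101 = 2 * x.length := by
    rw [BinOp.eval_sub_of_le (by omega) (by omega)]; omega
  have hD : 2 * x.length / 2 = x.length := by omega
  have hA1 : BinOp.eval w .add x.length 101 = x.length + 101 := BinOp.eval_add_of_lt (by omega)
  have hA0 : ∀ v, v < 2 ^ w → BinOp.eval w .add v 0 = v := fun v hv => by rw [BinOp.eval_add_of_lt (by omega), Nat.add_zero]
  set H : ℕ → ℕ := Function.update (outMem (relocated x) (2 * x.length + 101) cds) 100 φ.numVars with hH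
  set R₂ : ℕ → ℕ := Function.update (Function.update (Function.update (Function.update R₁ 4 Q) 10 cds.length) 11 Q) 12
    (x.length + 101) with hR₂
  have h3 : Exec w noOracle (block glueOps) ⟨merge R₁ (outMem (relocated x) (2 * x.length + 101) cds), []⟩ ⟨merge R₂ H, []⟩ 8 := by
    refine Exec.block' _ [] ?_
    simp (disch := first | decide | omega) only [glueOps, execOps_cons, execOps_nil, execOp, Operand.read,
      Operand.write, merge_apply_of_lt, merge_apply_of_le, update_merge_of_lt, update_merge_of_le, Function.update_self,
      Function.update_of_ne, h20, h21, hA0 _ (show 2 * x.length + 101 + cds.length < 2 ^ w by omega),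
      hA0 _ (show cds.length < 2 ^ w by omega), hS1, hS2, BinOp.eval_div, hD, hA1, Nat.div_one, hn, hR₂, hH, hQdef,
      Function.update_idem]
  -- 4. the simulation
  have hleny : cds.length = (inp Mt φ hwid).length := by rw [hcds, cnfCodes_eq_map_inp Mt φ hwid, List.length_map]
  have hH0 : ∀ a, Q ≤ a → H a = 0 := fun a ha => by
    rw [hH, Function.update_of_ne (by omega), outMem_of_le _ _ (by rw [hQdef] at ha; omega)]
    exact relocated_of_lt _ (by omega)
  obtain ⟨R₃, h4, hR₃4, hout⟩ := TM2Emu.simProgram_exec Mt.tm hrun (w := w) (O := noOracle) (Q := Q)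
    (s := 2 * x.length + 101) (R := R₂) (H := H) [] (by omega) (by omega) (by rw [← hleny]; omega) (by simp [hR₂])
    (by simp [hR₂, hleny]) (by simp [hR₂, hleny, hQdef]) (fun t ht => by
      rw [hH, Function.update_of_ne (by omega), outMem_add _ _ _ (by rw [hleny]; exact ht),
        List.getElem_of_eq (cnfCodes_eq_map_inp Mt φ hwid), List.getElem_map])
    hH0 (by rw [← hleny, ← hE]; omega) hγ hkey
  rw [TM2Emu.stk_haltList] at h4
  set S : ℕ → List ℕ := Function.update (fun _ => ([] : List ℕ)) i₁ (out.map (E.code Mt.tm.k₁)) with hS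
  set Hf : ℕ → ℕ := dataMem H Q E.κ S with hHf
  have hSlen : ∀ i, (S i).length ≤ out.length := fun i => by
    rw [hS]; rcases eq_or_ne i i₁ with rfl | hne
    · simp
    · rw [Function.update_of_ne hne]; simp
  -- 5. setup
  have hJ : out.length ≤ TM2Emu.heightBound Mt.tm cds.length T' := hlen
  have htop : Hf (Q + i₁) = BOTof Mt φ + E.κ * out.length := by
    rw [hHf, dataMem_ptr H Q S hi₁κ, hS, Function.update_self, List.length_map]
    unfold cellAddr BOTof; rw [← hQ, ← hE, ← hi₁]; ring
  have hBOT : BOTof Mt φ = Q + (E.κ + i₁) := by unfold BOTof; rw [← hQ, ← hE, ← hi₁, Nat.add_assoc]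
  have htoplt : BOTof Mt φ + E.κ * out.length < 2 ^ (w - 1) := by
    have h1 := cellAddr_le_cellAddr (Q := Q) (κ := E.κ) (i := i₁) hJ
    have h2 : cellAddr Q E.κ i₁ (TM2Emu.heightBound Mt.tm cds.length T') ≤
        cellAddr Q E.κ E.κ (TM2Emu.heightBound Mt.tm cds.length T') := by unfold cellAddr; omega
    have h3 : cellAddr Q E.κ i₁ out.length = BOTof Mt φ + E.κ * out.length := by unfold cellAddr BOTof; rw [← hQ, ← hE, ← hi₁]; ring
    omega
  have hzero : cellAddr Q E.κ 0 (out.length + 1) ≤ 2 ^ (w - 1) := by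
    have h3 := Nat.mul_le_mul_left E.κ hJ
    have e1 : cellAddr Q E.κ 0 (out.length + 1) = Q + E.κ + E.κ * out.length + E.κ := by unfold cellAddr; ring
    have e2 : cellAddr Q E.κ E.κ (TM2Emu.heightBound Mt.tm cds.length T') =
        Q + E.κ + E.κ * TM2Emu.heightBound Mt.tm cds.length T' + E.κ := rfl
    omega
  have hn100 : Hf 100 = φ.numVars := by rw [hHf, dataMem_of_lt _ _ _ (by omega), hH, Function.update_self]
  have hA2 : BinOp.eval w .add Q i₁ = Q + i₁ := BinOp.eval_add_of_lt (by omega)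
  have hA3 : BinOp.eval w .add Q (E.κ + i₁) = BOTof Mt φ := by rw [BinOp.eval_add_of_lt (by omega), hBOT]
  set R₄ : ℕ → ℕ := Function.update (Function.update (Function.update (Function.update (Function.update (Function.update
    (Function.update (Function.update R₃ 24 φ.numVars) 50 (Q + i₁)) 20 (BOTof Mt φ + E.κ * out.length)) 21 (BOTof Mt φ))
    22 (if BOTof Mt φ < BOTof Mt φ + E.κ * out.length then 1 else 0)) 25 0) 61 1) 60 0 with hR₄
  have h5 : Exec w noOracle (block (setupOps E.κ i₁)) ⟨merge R₃ Hf, []⟩ ⟨merge R₄ Hf, []⟩ 8 := by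
    refine Exec.block' _ [] ?_
    simp (disch := first | decide | omega) only [setupOps, execOps_cons, execOps_nil, execOp, Operand.read,
      Operand.write, merge_apply_of_lt, merge_apply_of_le, update_merge_of_lt, Function.update_self, Function.update_of_ne,
      hR₃4, hn100, hA2, htop, hA3, BinOp.eval_div_one, BinOp.eval_lt, BinOp.eval_band, Nat.and_self, hR₄]
  -- 6. the word size
  obtain ⟨R₅, t₅, h6, ht₅, h60, h61, hR₅⟩ := wLoop_exec (O := noOracle) (H := Hf) [] hww w R₄ 0 (by simp [hR₄]) (by simp [hR₄])
    (by omega) (by omega)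
  -- 7. the regions
  have hS3 : BinOp.eval w .sub w 1 = w - 1 := by rw [BinOp.eval_sub_of_le (by omega) hww]
  have hS4 : BinOp.eval w .sub w 2 = w - 2 := by rw [BinOp.eval_sub_of_le (by omega) hww]
  have hSh1 : BinOp.eval w .shl 1 (w - 1) = 2 ^ (w - 1) := by rw [BinOp.eval_shl_of_lt (by rw [one_mul]; exact hw1), one_mul]
  have hSh2 : BinOp.eval w .shl 1 (w - 2) = 2 ^ (w - 2) := by
    rw [BinOp.eval_shl_of_lt (by rw [one_mul]; exact lt_of_le_of_lt (Nat.pow_le_pow_right (by norm_num) (by omega)) hw1), one_mul]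
  have hA4 : BinOp.eval w .add (2 ^ (w - 1)) (2 ^ (w - 2)) = 2 ^ (w - 1) + 2 ^ (w - 2) := BinOp.eval_add_of_lt hw2
  set R₆ : ℕ → ℕ := Function.update (Function.update (Function.update (Function.update (Function.update (Function.update R₅
    50 (w - 1)) 30 (2 ^ (w - 1))) 50 (w - 2)) 51 (2 ^ (w - 2))) 31 (2 ^ (w - 1) + 2 ^ (w - 2))) 32 0 with hR₆
  have h7 : Exec w noOracle (block regionOps) ⟨merge R₅ Hf, []⟩ ⟨merge R₆ Hf, []⟩ 6 := by
    refine Exec.block' _ [] ?_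
    simp (disch := first | decide | omega) only [regionOps, execOps_cons, execOps_nil, execOp, Operand.read,
      Operand.write, merge_apply_of_lt, update_merge_of_lt, Function.update_self, Function.update_of_ne, h60, hS3, hSh1,
      hS4, hSh2, hA4, BinOp.eval_band, Nat.zero_and, hR₆]
  -- 8. clearing
  have h8 := clear_exec (w := w) (O := noOracle) (H := Hf) [] ((List.range 100).filter fun i => i ∉ keepRegs) R₆
    (fun i hi => by simp at hi; exact hi.1)
  have hlen8 : ((List.range 100).filter fun i => i ∉ keepRegs).length = 91 := by decide
  rw [hlen8] at h8
  have hregs : merge (fun a => if a ∈ (List.range 100).filter (fun i => i ∉ keepRegs) then 0 else R₆ a) Hf =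
      merge (preRegs (BOTof Mt φ + E.κ * out.length) (BOTof Mt φ) φ.numVars (2 ^ (w - 1)) (2 ^ (w - 1) + 2 ^ (w - 2)) w) Hf := by
    refine merge_congr fun a ha => ?_
    simp only [List.mem_filter, List.mem_range, keepRegs, List.mem_cons, List.not_mem_nil, or_false, not_or, preRegs]
    by_cases h20a : a = 20
    · subst h20a; simp [hR₆, hR₅ 20 (by decide) (by decide), hR₄]
    by_cases h21a : a = 21
    · subst h21a; simp [hR₆, hR₅ 21 (by decide) (by decide), hR₄]
    by_cases h22a : a = 22
    · subst h22a; simp [hR₆, hR₅ 22 (by decide) (by decide), hR₄]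
    by_cases h24a : a = 24
    · subst h24a; simp [hR₆, hR₅ 24 (by decide) (by decide), hR₄]
    by_cases h30a : a = 30
    · subst h30a; simp [hR₆]
    by_cases h31a : a = 31
    · subst h31a; simp [hR₆]
    by_cases h60a : a = 60
    · subst h60a; simp [hR₆, h60]
    by_cases h25a : a = 25
    · subst h25a; simp [hR₆, hR₅ 25 (by decide) (by decide), hR₄]
    by_cases h32a : a = 32
    · subst h32a; simp [hR₆]
    simp [ha, h20a, h21a, h22a, h24a, h30a, h31a, h60a, h25a, h32a]
  rw [hregs] at h8
  -- assembling
  obtain ⟨t₄, ht₄, h4'⟩ := h4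
  refine ⟨Hf, 7 * x.length + (t₁ + (8 + (t₄ + (8 + (t₅ + (6 + 91)))))),
    h1.seqs_cons (h2.seqs_cons (h3.seqs_cons (h4'.seqs_cons (h5.seqs_cons (h6.seqs_cons (h7.seqs_cons (Exec.seqs_one h8))))))),
    ?_, ?_, fun a ha => ?_, fun a => ?_, hout, htoplt⟩
  · unfold preTime; rw [← hx, ← hcds, hleny]; omega
  · have := streamAt_dataMem H Q hi₁κ S
    rw [hS, Function.update_self, List.length_map] at this
    rwa [hBOT, ← Nat.add_assoc]
  · exact dataMem_eq_zero_of_le H Q hκ S hSlen (le_trans hzero ha)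
  · refine dataMem_le H Q S hSlen (fun b hb => ?_) (fun i c hc => ?_) ?_ a
    · rw [hH]
      rcases eq_or_ne b 100 with rfl | hb100
      · rw [Function.update_self]
        have : φ.numVars ∈ x := by rw [hx, KSatTranscoder.encodeCNFWords_eq]; simp
        have := hxw _ this; omega
      · rw [Function.update_of_ne hb100]
        have hcdsw : ∀ c ∈ cds, c < 2 ^ w := fun c hc => by
          rw [hcds, cnfCodes_eq_map_inp Mt φ hwid] at hc
          obtain ⟨a', -, rfl⟩ := List.mem_map.1 hc
          exact lt_of_le_of_lt (hgood.code_le _ a' (TM2Emu.mem_alphabet_k₀ _ a')) hγ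
        unfold outMem; split_ifs with h1
        · rw [List.getD_eq_getElem?_getD]
          cases h : cds[b - (2 * x.length + 101)]? with
          | none => simp
          | some c => have := hcdsw c (List.mem_of_getElem? h); simp; omega
        · exact Nat.le_sub_one_of_lt (relocated_lt x hxw (by omega) b)
    · rw [hS] at hc
      rcases eq_or_ne i i₁ with rfl | hne
      · rw [Function.update_self] at hc
        obtain ⟨a', ha', rfl⟩ := List.mem_map.1 hc
        have := hgood.code_le _ a' (hout a' ha'); omega
      · rw [Function.update_of_ne hne] at hc; simp at hc
    · have h1 := cellAddr_le_cellAddr (Q := Q) (κ := E.κ) (i := E.κ) hJ; omega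

end preExec

/-! ### Bookkeeping along the list of leaves -/

section leaves

variable {kk : ℕ}

/-- The accumulated answer after `i` leaves: `1` iff one of them is satisfiable. [folklore] -/
def accOf (Ψ : List (KCNF kk)) (i : ℕ) : ℕ := if ∃ ψ ∈ Ψ.take i, ψ.Satisfiable then 1 else 0

/-- The number of symbols of the output consumed after `i` leaves. [folklore] -/
def offOf (Ψ : List (KCNF kk)) (i : ℕ) : ℕ := (KCNF.encodeList (Ψ.take i)).length

/-- `encodeList` is additive. [folklore] -/
theorem encodeList_append (l₁ l₂ : List (KCNF kk)) :
    KCNF.encodeList (l₁ ++ l₂) = KCNF.encodeList l₁ ++ KCNF.encodeList l₂ := by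
  simp [KCNF.encodeList]

/-- The output split at leaf `i`. [folklore] -/
theorem encodeList_split (Ψ : List (KCNF kk)) {i : ℕ} (hi : i < Ψ.length) :
    KCNF.encodeList Ψ = KCNF.encodeList (Ψ.take i) ++ ((Ψ[i]).encode ++ [Γ'.blank]) ++ KCNF.encodeList (Ψ.drop (i + 1)) := by
  conv_lhs => rw [← List.take_append_drop i Ψ, List.drop_eq_getElem_cons hi]
  rw [encodeList_append, List.append_assoc]
  congr 1

/-- One more leaf consumed. [folklore] -/
theorem offOf_succ (Ψ : List (KCNF kk)) {i : ℕ} (hi : i < Ψ.length) :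
    offOf Ψ (i + 1) = offOf Ψ i + ((Ψ[i]).encode.length + 1) := by
  unfold offOf
  rw [List.take_succ_eq_append_getElem hi, encodeList_append]
  simp [KCNF.encodeList]

/-- The symbols of leaf `i` are still there. [folklore] -/
theorem offOf_add_le (Ψ : List (KCNF kk)) {i : ℕ} (hi : i < Ψ.length) :
    offOf Ψ i + ((Ψ[i]).encode.length + 1) ≤ (KCNF.encodeList Ψ).length := by
  have := congrArg List.length (encodeList_split Ψ hi)
  simp only [List.length_append, List.length_cons, List.length_nil] at this
  unfold offOf; omega

/-- All symbols consumed at the end. [folklore] -/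
theorem offOf_length (Ψ : List (KCNF kk)) : offOf Ψ Ψ.length = (KCNF.encodeList Ψ).length := by
  unfold offOf; rw [List.take_length]

/-- No leaf, no answer. [folklore] -/
theorem accOf_zero (Ψ : List (KCNF kk)) : accOf Ψ 0 = 0 := by simp [accOf]

/-- The accumulated answer is a bit. [folklore] -/
theorem accOf_le_one (Ψ : List (KCNF kk)) (i : ℕ) : accOf Ψ i ≤ 1 := by unfold accOf; split_ifs <;> omega

/-- One more leaf. [folklore] -/
theorem accOf_succ (Ψ : List (KCNF kk)) {i : ℕ} (hi : i < Ψ.length) :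
    accOf Ψ (i + 1) = if 0 < accOf Ψ i + (if (Ψ[i]).Satisfiable then 1 else 0) then 1 else 0 := by
  unfold accOf
  rw [List.take_succ_eq_append_getElem hi]
  simp only [List.mem_append, List.mem_singleton, or_and_right, exists_or, exists_eq_left]
  by_cases h1 : ∃ ψ ∈ Ψ.take i, ψ.Satisfiable <;> by_cases h2 : (Ψ[i]).Satisfiable <;> simp [h1, h2]

/-- The final answer. [folklore] -/
theorem accOf_length (Ψ : List (KCNF kk)) : accOf Ψ Ψ.length = if ∃ ψ ∈ Ψ, ψ.Satisfiable then 1 else 0 := by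
  unfold accOf; rw [List.take_length]

/-- `k`-CNF satisfiability is satisfiability of the clause list. [folklore] -/
theorem kcnf_satisfiable_iff (ψ : KCNF kk) : ψ.Satisfiable ↔ CNF.Satisfiable ψ.clauses := by
  rw [KCNF.satisfiable_iff_exists_eval]; rfl

/-- A clause list with the empty clause is unsatisfiable. [folklore] -/
theorem not_satisfiable_of_nil_mem {cs : CNF ℕ} (h : [] ∈ cs) : ¬ CNF.Satisfiable cs := by
  rintro ⟨σ, hσ⟩
  unfold CNF.eval at hσ
  rw [List.all_eq_true] at hσ
  simpa using hσ [] h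

/-- The padding clause is a tautology, so padding preserves satisfiability. [folklore] -/
theorem satisfiable_append_padClause (cs : CNF ℕ) (n : ℕ) : CNF.Satisfiable (cs ++ [padClause n]) ↔ CNF.Satisfiable cs := by
  have htaut : ∀ σ : ℕ → Bool, CNF.eval [padClause n] σ = true := fun σ => by
    cases h : σ (n - 1) <;> simp [CNF.eval, padClause, Literal.eval, h]
  constructor
  · rintro ⟨σ, hσ⟩
    refine ⟨σ, ?_⟩
    unfold CNF.eval at hσ ⊢
    rw [List.all_append, Bool.and_eq_true] at hσ
    exact hσ.1
  · rintro ⟨σ, hσ⟩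
    refine ⟨σ, ?_⟩
    have := htaut σ
    unfold CNF.eval at hσ this ⊢
    rw [List.all_append, hσ, this]; rfl

/-- **The presented formula has the leaf's answer** (unless the leaf has an empty clause).
[folklore] -/
theorem satisfiable_pres_iff {k n : ℕ} {cs : CNF ℕ} (h : [] ∉ cs) : CNF.Satisfiable (pres k n cs) ↔ CNF.Satisfiable cs := by
  rw [pres_of_not_mem h]
  split_ifs
  · exact satisfiable_append_padClause cs n
  · rw [List.append_nil]

/-- The presented formula is a `k`-CNF. [folklore] -/
theorem isWidthLE_pres {k n : ℕ} {cs : CNF ℕ} (hw : cs.IsWidthLE k) : (pres k n cs).IsWidthLE k := by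
  unfold pres
  split_ifs with h1 h2
  · intro c hc; simp at hc
  · intro c hc
    rcases List.mem_append.1 hc with hc | hc
    · exact hw c hc
    · simp only [List.mem_singleton] at hc; subst hc; simp [padClause]; exact h2.1
  · exact hw

/-- A clause list on fewer than `n` variables does not contain the padding clause. [folklore] -/
theorem padClause_not_mem {n : ℕ} {cs : CNF ℕ} (h : CNF.numVars cs < n) : padClause n ∉ cs := fun hm => by
  have : n - 1 + 1 ≤ CNF.numVars cs := by
    rw [numVars_eq_lmax]
    exact le_lmax_of_mem (List.mem_map.2 ⟨(n - 1, true), List.mem_flatten.2 ⟨_, hm, by simp [padClause]⟩, rfl⟩)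
  omega

/-- The presented formula has no repeated clause. [folklore] -/
theorem nodup_pres {k n : ℕ} {cs : CNF ℕ} (hnd : cs.Nodup) : (pres k n cs).Nodup := by
  unfold pres
  split_ifs with h1 h2
  · exact List.nodup_nil
  · exact List.nodup_append.2 ⟨hnd, List.nodup_singleton _, fun c hc c' hc' heq => by
      simp only [List.mem_singleton] at hc'; subst hc'; subst heq; exact padClause_not_mem h2.2 hc⟩
  · exact hnd

/-- **Narrow formulas are sparse**: pairwise distinct nonempty clauses of width `≤ 1` are at most
two per variable. [folklore] -/
theorem length_le_two_mul_numVars {cs : CNF ℕ} (hw : cs.IsWidthLE 1) (hnd : cs.Nodup) (hne : [] ∉ cs) :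
    cs.length ≤ 2 * CNF.numVars cs := by
  classical
  have hsingle : ∀ c ∈ cs, ∃ l, c = [l] := fun c hc => by
    have h1 := hw c hc
    match c, h1 with
    | [], _ => exact absurd hc hne
    | [l], _ => exact ⟨l, rfl⟩
  let f : Clause ℕ → ℕ × Bool := fun c => c.headD (0, true)
  have hinj : ∀ c ∈ cs, ∀ c' ∈ cs, f c = f c' → c = c' := fun c hc c' hc' heq => by
    obtain ⟨l, rfl⟩ := hsingle c hc
    obtain ⟨l', rfl⟩ := hsingle c' hc'
    simp only [f, List.headD_cons] at heq
    rw [heq]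
  have hnd' : (cs.map f).Nodup := hnd.map_on hinj
  have hsub : ∀ p ∈ cs.map f, p ∈ (Finset.range (CNF.numVars cs)) ×ˢ (Finset.univ : Finset Bool) := fun p hp => by
    obtain ⟨c, hc, rfl⟩ := List.mem_map.1 hp
    obtain ⟨l, rfl⟩ := hsingle c hc
    simp only [f, List.headD_cons, Finset.mem_product, Finset.mem_range, Finset.mem_univ, and_true]
    have : l.1 + 1 ≤ CNF.numVars cs := by
      rw [numVars_eq_lmax]
      exact le_lmax_of_mem (List.mem_map.2 ⟨l, List.mem_flatten.2 ⟨_, hc, List.mem_singleton_self _⟩, rfl⟩)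
    omega
  have hcard := (List.toFinset_card_of_nodup hnd').symm.le.trans (Finset.card_le_card fun p hp => hsub p (List.mem_toFinset.1 hp))
  rw [Finset.card_product, Finset.card_range, Finset.card_univ, Fintype.card_bool, List.length_map] at hcard
  omega

/-- **The presented formula is sparse**: density `max (C + 1) 2` when the leaf (on the variables of
the input, `numVars ≤ n`) has at most `C · n` clauses. [folklore] -/
theorem numClauses_pres_le {k n C Cd : ℕ} {cs : CNF ℕ} (hw : cs.IsWidthLE k) (hnd : cs.Nodup) (hlen : cs.length ≤ C * n)
    (hnv : CNF.numVars cs ≤ n) (hCd : max (C + 1) 2 ≤ Cd) :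
    CNF.numClauses (pres k n cs) ≤ Cd * CNF.numVars (pres k n cs) := by
  have hC1 : C + 1 ≤ Cd := le_trans (le_max_left _ _) hCd
  have h2 : 2 ≤ Cd := le_trans (le_max_right _ _) hCd
  by_cases hE : [] ∈ cs
  · rw [pres_of_mem hE]; exact Nat.zero_le _
  · rw [pres_of_not_mem hE, CNF.numClauses]
    split_ifs with h
    · rw [numVars_append_padClause h.2, List.length_append, List.length_singleton]
      have hn : 1 ≤ n := by omega
      calc cs.length + 1 ≤ C * n + n := by omega
        _ = (C + 1) * n := by ring
        _ ≤ Cd * n := Nat.mul_le_mul_right _ hC1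
    · rw [List.append_nil]
      rcases Nat.lt_or_ge k 2 with hk | hk
      · have hw1 : cs.IsWidthLE 1 := fun c hc => by have := hw c hc; omega
        exact (length_le_two_mul_numVars hw1 hnd hE).trans (Nat.mul_le_mul_right _ h2)
      · have hnn : CNF.numVars cs = n := by
          by_contra hne; exact h ⟨hk, lt_of_le_of_ne hnv hne⟩
        rw [hnn]
        calc cs.length ≤ C * n := hlen
          _ ≤ Cd * n := Nat.mul_le_mul_right _ (by omega)

/-- `numVars` of the presented formula is at most `n`. [folklore] -/
theorem numVars_pres_le {k n : ℕ} {cs : CNF ℕ} (hnv : CNF.numVars cs ≤ n) : CNF.numVars (pres k n cs) ≤ n := by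
  by_cases hE : [] ∈ cs
  · rw [pres_of_mem hE]; exact Nat.zero_le _
  · rw [pres_of_not_mem hE]
    split_ifs with h
    · rw [numVars_append_padClause h.2]
    · rwa [List.append_nil]

/-- The output of a run of the decision program pins its first two cells. [folklore] -/
theorem mem_of_readOut_singleton {m : ℕ → ℕ} {b : ℕ} (h : readOut m = [b]) : m 0 = 1 ∧ m 1 = b := by
  have hl := congrArg List.length h
  rw [readOut_length, List.length_singleton] at hl
  refine ⟨hl, ?_⟩
  unfold readOut at h
  rw [hl] at h
  simpa [readSeg] using h

end leaves

/-! ### The loop invariant -/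

section main

variable {kk : ℕ}

/-- **The loop invariant** after `i` leaves: empty query log; the stream pointer `|consumed|` cells
down, the bottom, the flag `[i < N]`, `n`, the accumulated answer, the regions and the generation `i`
in their registers; the data below `Bv` still that of the build phase; every stamp at most the
generation; every cell a word. [folklore] -/
def LoopInv (Ψ : List (KCNF kk)) (Hf : ℕ → ℕ) (BOT κ n Bv Sv QE w : ℕ) (i : ℕ) (st : Store) : Prop :=
  st.queries = [] ∧ ∃ R D : ℕ → ℕ, st.mem = merge R D ∧
    R 20 = BOT + κ * ((KCNF.encodeList Ψ).length - offOf Ψ i) ∧ R 21 = BOT ∧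
    R 22 = (if i < Ψ.length then 1 else 0) ∧ R 24 = n ∧ R 25 = accOf Ψ i ∧ R 30 = Bv ∧ R 31 = Sv ∧ R 32 = i ∧
    (∀ a, 100 ≤ a → a < Bv → D a = Hf a) ∧ (∀ a, a < QE → D (Sv + a) ≤ i) ∧ MemLE (2 ^ w - 1) (merge R D)

/-- The per-leaf body budget: the parser, the tail, slack. [folklore] -/
def leafTime (k n w : ℕ) (ψ : KCNF kk) : ℕ :=
  formulaTime ψ + 7 * (encodeCNFWords (pres k n ψ.clauses)).length + 4 * w + 76

/-- The body budget as a function of the iteration. [folklore] -/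
def leafTimeAt (k n w : ℕ) (Ψ : List (KCNF kk)) (i : ℕ) : ℕ := ((Ψ[i]?).map (leafTime k n w)).getD 0

open scoped Classical in
/-- **One iteration of the driver's loop** (the `hbody` clause of `SProg.outputsWithin_withSubrunLoop_sum`):
from the invariant after `i < N` leaves, the flag is set, the leaf body presents
`y = encodeCNFWords (pres k n Ψ[i].clauses)` to the emulator at word size
`ws = k' (numVars + inputWidth y)` (environment: cells from `Bv = 2^(W-1)`, stamps from
`Sv = Bv + 2^(W-2)`, generation `i + 1`, region `2^(W-2)`), the sparse-`k`-SAT program halts on it with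
its answer bit, and `post` re-establishes the invariant after `i + 1` leaves. [folklore] -/
theorem leaf_step (Mt : TM2ComputableAux Γ' Γ') (k k' : ℕ) {M : Program} {w n Cs Cd nmax : ℕ} (Ψ : List (KCNF k))
    {Hf : ℕ → ℕ} {BOT : ℕ}
    (hκ : 0 < (TM2Emu.enc Mt.tm).κ) (hBOT : 100 ≤ BOT)
    (hstream : StreamAt Hf BOT (TM2Emu.enc Mt.tm).κ (KCNF.encodeList Ψ).length ((KCNF.encodeList Ψ).map (pcodes Mt).cd))
    (hsep : (pcodes Mt).Sep (KCNF.encodeList Ψ)) (hBOTlt : BOT + (TM2Emu.enc Mt.tm).κ * (KCNF.encodeList Ψ).length < 2 ^ (w - 1))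
    (hΨn : ∀ ψ ∈ Ψ, CNF.numVars ψ.clauses ≤ n) (hΨc : ∀ ψ ∈ Ψ, ψ.clauses.length ≤ Cs * n)
    (hΨnd : ∀ ψ ∈ Ψ, ψ.clauses.Nodup) (hCd : max (Cs + 1) 2 ≤ Cd)
    (hM : ∀ cs : CNF ℕ, cs.IsWidthLE k → cs.Nodup → CNF.numClauses cs ≤ Cd * CNF.numVars cs → CNF.numVars cs ≤ n →
      ∃ (c : Cfg) (t : ℕ), t ≤ nmax ∧
        HaltsWithin M (k' * (CNF.numVars cs + inputWidth (encodeCNFWords cs))) noOracle zeroCoins (encodeCNFWords cs) t c ∧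
        readOut c.mem = [if cs.Satisfiable then 1 else 0])
    (hw8 : 8 ≤ w) (hnn : n + n < 2 ^ w) (hnw : n + w < 2 ^ w) (hsz : Nat.size n + 2 ≤ w)
    (hcw : ∀ ψ ∈ Ψ, (KSatTranscoder.clauseWords ψ.clauses).length + 9 < 2 ^ (w - 2)) (hN : Ψ.length + 1 < 2 ^ w)
    (hws : ∀ ψ ∈ Ψ, k' * (CNF.numVars (pres k n ψ.clauses) + inputWidth (encodeCNFWords (pres k n ψ.clauses))) + 2 ≤ w)
    (hMc : Program.maxConst M < 2 ^ (w - 2)) (hγ : (TM2Emu.enc Mt.tm).γ + 1 < 2 ^ w) :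
    ∀ i, i < Ψ.length → ∀ st, LoopInv Ψ Hf BOT (TM2Emu.enc Mt.tm).κ n (2 ^ (w - 1)) (2 ^ (w - 1) + 2 ^ (w - 2)) (2 ^ (w - 2)) w i st →
      st.mem 22 ≠ 0 ∧
      ∃ (st₁ : Store) (t₁ : ℕ), t₁ ≤ leafTimeAt k n w Ψ i ∧
        Exec w noOracle (leafBody (pcodes Mt) (TM2Emu.enc Mt.tm).κ k k') st st₁ t₁ ∧
      ∃ (E : Env) (V : ℕ) (y : List ℕ) (nr : ℕ) (dh : Cfg),
        EnvOK lay E w ∧ Program.maxConst M ≤ V ∧ V < E.Q ∧ V ≤ 2 ^ w - 1 ∧ 2 ^ E.ws - 1 ≤ V ∧ 1 ≤ V ∧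
        TInv lay E (2 ^ w - 1) st₁.mem ∧ Agree E st₁.mem (init E.ws y).mem ∧
        HaltsWithin M E.ws noOracle zeroCoins y nr dh ∧ nr ≤ nmax ∧
        ∀ m₂ : ℕ → ℕ, Agree E m₂ dh.mem → TInv lay E (2 ^ w - 1) m₂ →
          (∀ c, ¬ Foot lay E c → m₂ c = st₁.mem c) →
          ∃ (st₃ : Store) (t₃ : ℕ), t₃ ≤ 11 ∧ Exec w noOracle post ⟨m₂, st₁.queries⟩ st₃ t₃ ∧
            LoopInv Ψ Hf BOT (TM2Emu.enc Mt.tm).κ n (2 ^ (w - 1)) (2 ^ (w - 1) + 2 ^ (w - 2)) (2 ^ (w - 2)) w (i + 1) st₃ := by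
  intro i hi st ⟨hqs, R, D, hmem, h20, h21, h22, h24, h25, h30, h31, h32, hD, hSt, hLE⟩
  obtain ⟨stm, stq⟩ := st
  simp only at hqs hmem
  subst hqs; subst hmem
  set κ := (TM2Emu.enc Mt.tm).κ with hκdef
  set C := pcodes Mt with hCdef
  set Bv := 2 ^ (w - 1) with hBv
  set QE := 2 ^ (w - 2) with hQE
  set Sv := Bv + QE with hSv
  set J := (KCNF.encodeList Ψ).length with hJ
  set ψ := Ψ[i] with hψ
  have hψmem : ψ ∈ Ψ := List.getElem_mem hi
  -- word-size facts
  have hBv2 : Bv = QE + QE := by rw [hBv, hQE, ← two_mul, ← pow_succ']; congr 1; omega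
  have hw2 : Bv + Bv = 2 ^ w := by rw [hBv, ← two_mul, ← pow_succ']; congr 1; omega
  have hQE64 : 64 ≤ QE := by
    rw [hQE]; calc (64 : ℕ) = 2 ^ 6 := by norm_num
      _ ≤ 2 ^ (w - 2) := Nat.pow_le_pow_right (by norm_num) (by omega)
  have hww : w < 2 ^ w := Nat.lt_two_pow_self
  have hVT : 2 ^ w - 1 + 1 = 2 ^ w := Nat.sub_add_cancel Nat.one_le_two_pow
  -- the flag
  refine ⟨by change merge R D 22 ≠ 0; rw [merge_apply_of_lt (by decide), h22, if_pos hi]; exact one_ne_zero, ?_⟩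
  -- the stream of leaf `i`
  have hsplit := encodeList_split Ψ hi
  rw [← hψ] at hsplit
  have hoff := offOf_add_le Ψ hi
  rw [← hψ, ← hJ] at hoff
  have hst : StreamAt D BOT κ (J - offOf Ψ i) ((ψ.encode ++ [Γ'.blank]).map C.cd) := by
    have h1 := hstream
    rw [hsplit, List.map_append, List.map_append, streamAt_append, streamAt_append] at h1
    have h2 := h1.1.2
    rw [List.length_map] at h2
    refine h2.congr fun j' hj1 hj2 => hD _ (by omega) ?_
    have := Nat.mul_le_mul_left κ (show j' ≤ J by omega)
    omega
  have hsepψ : C.Sep (ψ.encode ++ [Γ'.blank]) := by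
    rw [hsplit, PCodes.sep_append, PCodes.sep_append] at hsep; exact hsep.1.2
  -- the leaf body
  have hpw : ∀ c ∈ ψ.clauses, ∀ l ∈ c, 2 ^ (l.1.bits.length + 1) < 2 ^ w := fun c hc l hl => by
    have h1 : l.1 < n := by
      have := hΨn ψ hψmem
      have h2 : l.1 + 1 ≤ CNF.numVars ψ.clauses := by
        rw [numVars_eq_lmax]
        exact le_lmax_of_mem (List.mem_map.2 ⟨l, List.mem_flatten.2 ⟨c, hc, hl⟩, rfl⟩)
      omega
    refine Nat.pow_lt_pow_right (by norm_num) ?_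
    have : l.1.bits.length ≤ Nat.size n := by rw [Nat.size_eq_bits_len]; exact Nat.size_le_size h1.le
    omega
  obtain ⟨R', t₁, hexb, ht₁, h20', h32', h33', h43', h53', h52', hR'⟩ := leafBody_exec (w := w) (O := noOracle) (C := C)
    (κ := κ) k k' ψ (H := D) (R := R) (BOT := BOT) (j := J - offOf Ψ i) (Bv := Bv) (Sv := Sv) (G := i) (n := n) hBOT
    (by rw [hBv2]; omega) h20 h24 h30 h31 h32 hst hsepψ (by
      have := Nat.mul_le_mul_left κ (Nat.sub_le J (offOf Ψ i)); omega)
    (by have := hcw ψ hψmem; omega) (by have := hcw ψ hψmem; omega) (by omega)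
    hnn hnw (hΨn ψ hψmem) hpw (by have := hws ψ hψmem; omega) []
  set y := encodeCNFWords (pres k n ψ.clauses) with hy
  set n₁ := CNF.numVars (pres k n ψ.clauses) with hn₁
  set ws := k' * (n₁ + inputWidth y) with hwsdef
  set D₁ := stampData (outMem (if [] ∈ ψ.clauses then outMem D (Bv + 3) (KSatTranscoder.clauseWords ψ.clauses) else D) Bv
    (y.length :: y)) Bv Sv (i + 1) (2 ^ ws) (y.length :: y) (y.length + 1) with hD₁
  refine ⟨⟨merge R' D₁, []⟩, t₁, ?_, hexb, ?_⟩
  · -- the time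
    unfold leafTimeAt; rw [List.getElem?_eq_getElem hi, ← hψ]; simpa [leafTime] using ht₁
  -- the environment and the run
  obtain ⟨hyV, hylen⟩ := pres_words_lt (k := k) (n := n) (V := 2 ^ w) (cs := ψ.clauses) hnn (by omega)
    (by have := hcw ψ hψmem; omega) (hΨn ψ hψmem) (fun a ha => by
      -- words of the leaf are below `2 ^ w` (shown inside `leafBody_exec` too; re-derived here)
      simp only [KSatTranscoder.clauseWords, List.mem_flatMap, List.mem_cons, List.mem_map] at ha
      obtain ⟨c, hc, ha⟩ := ha
      rcases ha with rfl | ⟨l, hl, rfl⟩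
      · have h1 : (c.length :: c.map litWord).length ≤ (KSatTranscoder.clauseWords ψ.clauses).length := by
          have := ((List.singleton_sublist.2 hc).flatMap (fun c : List (ℕ × Bool) => c.length :: c.map litWord)).length_le
          simpa [KSatTranscoder.clauseWords] using this
        simp only [List.length_cons, List.length_map] at h1
        have := hcw ψ hψmem; omega
      · have h1 : l.1 < n := by
          have := hΨn ψ hψmem
          have h2 : l.1 + 1 ≤ CNF.numVars ψ.clauses := by
            rw [numVars_eq_lmax]
            exact le_lmax_of_mem (List.mem_map.2 ⟨l, List.mem_flatten.2 ⟨c, hc, hl⟩, rfl⟩)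
          omega
        unfold litWord; cases l.2 <;> simp <;> omega)
  rw [← hy] at hyV hylen
  have hyQE : y.length + 1 ≤ QE := by
    have := hcw ψ hψmem
    have hl : y.length ≤ (KSatTranscoder.clauseWords ψ.clauses).length + 5 := by
      rw [hy]
      by_cases hE : [] ∈ ψ.clauses
      · rw [pres_of_mem hE]; simp [encodeCNFWords]
      · rw [pres_of_not_mem hE, KSatTranscoder.encodeCNFWords_eq, clauseWords_append]
        simp only [List.length_cons, List.length_append]
        split_ifs with h
        · rw [clauseWords_padClause n (by omega)]; simp
        · simp [KSatTranscoder.clauseWords]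
    omega
  obtain ⟨dh, nr, hnr, hhalt, hout⟩ := hM (pres k n ψ.clauses) (isWidthLE_pres ψ.length_le) (nodup_pres (hΨnd ψ hψmem))
    (numClauses_pres_le ψ.length_le (hΨnd ψ hψmem) (hΨc ψ hψmem) (hΨn ψ hψmem) hCd) (numVars_pres_le (hΨn ψ hψmem))
  rw [← hy, ← hn₁, ← hwsdef] at hhalt
  obtain ⟨hdh0, hdh1⟩ := mem_of_readOut_singleton hout
  set E : Env := ⟨Bv, Sv, i + 1, ws, QE⟩ with hE
  have hwsw : ws + 2 ≤ w := hws ψ hψmem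
  have hOK : EnvOK lay E w :=
    { t1_ne_t2 := by decide
      t1_ne_ta := by decide
      t2_ne_ta := by decide
      rB_ne := by decide
      rS_ne := by decide
      rGen_ne := by decide
      rP_ne := by decide
      regs_lt := fun r hr => by simp only [lay, Layout.regs, List.mem_cons, List.not_mem_nil, or_false] at hr; change r < Bv ∧ r < Sv; omega
      disj := Or.inl (le_refl _)
      fitB := by change Bv + QE ≤ 2 ^ w; omega
      fitS := by change Sv + QE ≤ 2 ^ w; omega
      ws_le := by change ws ≤ w; omega }
  have hold : ∀ a, y.length + 1 ≤ a → a < QE →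
      (outMem (if [] ∈ ψ.clauses then outMem D (Bv + 3) (KSatTranscoder.clauseWords ψ.clauses) else D) Bv (y.length :: y))
        (Sv + a) < i + 1 := fun a _ ha => by
    rw [outMem_of_le _ _ (by simp; omega)]
    have := hSt a ha
    split_ifs
    · rw [outMem_of_le _ _ (by have := hcw ψ hψmem; omega)]; omega
    · omega
  have h2ws : 2 ^ ws ≤ QE := by rw [hQE]; exact Nat.pow_le_pow_right (by norm_num) (by omega)
  refine ⟨E, QE - 1, y, nr, dh, hOK, by omega, by change QE - 1 < QE; omega,
    by omega, by change 2 ^ ws - 1 ≤ QE - 1; omega, by omega, ?_, ?_, hhalt, hnr, ?_⟩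
  · -- the target invariant
    refine ⟨⟨?_, ?_, ?_, ?_⟩, ?_, ?_⟩
    · change merge R' D₁ 30 = Bv; rw [merge_apply_of_lt (by decide), hR' 30 (by decide), h30]
    · change merge R' D₁ 31 = Sv; rw [merge_apply_of_lt (by decide), hR' 31 (by decide), h31]
    · change merge R' D₁ 32 = i + 1; rw [merge_apply_of_lt (by decide), h32']
    · change merge R' D₁ 33 = 2 ^ ws; rw [merge_apply_of_lt (by decide), h33']
    · exact present_stampLE (ws := ws) (by omega) (le_refl _) hyQE hold
    · have hq : (leafBody C κ k k').QueryFree := leafBody_queryFree _ _ _ _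
      have hκJ : κ ≤ κ * J := Nat.le_mul_of_pos_right κ (by omega)
      have hk'w : k' ≤ w :=
        le_trans (Nat.le_mul_of_pos_right k' (show 0 < n₁ + inputWidth y by have := inputWidth_pos y; omega)) (by omega)
      have hcle : CLE (2 ^ w - 1) (leafBody C κ k k') :=
        cle_leafBody C κ k k' (by omega) (by have := pcodes_sup_le Mt; rw [← hCdef] at this; omega) (by omega) (by omega)
      exact Exec.memLE (V := 2 ^ w - 1) (le_refl _) (by omega) hexb hq hcle hLE
  · exact present_agree (ws := ws) (by omega) hyQE (le_refl _) hold
  · -- post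
    intro m₂ hag hinv hfr
    have hreg : ∀ c, c < 100 → c ≠ 34 → c ≠ 35 → c ≠ 36 → m₂ c = R' c := fun c hc h1 h2 h3 => by
      rw [hfr c (by simp only [Foot, lay, not_or, not_and, not_lt]; change _ ∧ _ ∧ _ ∧ (Bv ≤ c → _) ∧ (Sv ≤ c → _); omega)]
      exact merge_apply_of_lt hc
    have hQ1 : 1 < E.Q := by change 1 < QE; omega
    have hb : edec E m₂ 1 = if (pres k n ψ.clauses).Satisfiable then 1 else 0 := by rw [hag 1 hQ1, hdh1]
    obtain ⟨m', t₃, hexp, ht₃, h25', h22', -, hfr'⟩ := post_exec (w := w) (O := noOracle) (E := E) (VT := 2 ^ w - 1)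
      (m := m₂) hOK hVT hinv hQ1 (by change 26 < Bv ∧ 26 < Sv; omega)
      (by rw [hreg 25 (by decide) (by decide) (by decide) (by decide), hR' 25 (by decide), h25]; exact accOf_le_one Ψ i)
      (by rw [hb]; split_ifs <;> omega) []
    refine ⟨⟨m', []⟩, t₃, ht₃, hexp, rfl, m', m', (merge_self m').symm, ?_, ?_, ?_, ?_, ?_, ?_, ?_, ?_, ?_, ?_, ?_⟩
    · -- the stream pointer
      rw [hfr' 20 (by decide) (by decide) (by decide) (by decide), hreg 20 (by decide) (by decide) (by decide) (by decide), h20',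
        offOf_succ Ψ hi, ← hψ, Nat.sub_sub]
    · rw [hfr' 21 (by decide) (by decide) (by decide) (by decide), hreg 21 (by decide) (by decide) (by decide) (by decide),
        hR' 21 (by decide), h21]
    · -- the flag
      rw [h22', hreg 21 (by decide) (by decide) (by decide) (by decide), hreg 20 (by decide) (by decide) (by decide) (by decide),
        hR' 21 (by decide), h21, h20']
      have hoff' : offOf Ψ (i + 1) = offOf Ψ i + (ψ.encode.length + 1) := by rw [offOf_succ Ψ hi, ← hψ]
      by_cases hi1 : i + 1 < Ψ.length
      · rw [if_pos hi1, if_pos]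
        have h1 := offOf_add_le Ψ hi1
        rw [← hJ, hoff'] at h1
        have : 1 ≤ J - offOf Ψ i - (ψ.encode.length + 1) := by omega
        have := Nat.mul_le_mul_left κ this
        omega
      · have hN' : i + 1 = Ψ.length := by omega
        rw [if_neg hi1, if_neg]
        have h1 := offOf_length Ψ
        rw [← hN', hoff', ← hJ] at h1
        rw [show J - offOf Ψ i - (ψ.encode.length + 1) = 0 by omega, Nat.mul_zero, Nat.add_zero]
        exact lt_irrefl _
    · rw [hfr' 24 (by decide) (by decide) (by decide) (by decide), hreg 24 (by decide) (by decide) (by decide) (by decide),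
        hR' 24 (by decide), h24]
    · -- the accumulated answer
      rw [h25', hreg 43 (by decide) (by decide) (by decide) (by decide), hreg 25 (by decide) (by decide) (by decide) (by decide),
        h43', hR' 25 (by decide), h25, hb, accOf_succ Ψ hi, ← hψ]
      by_cases hE : [] ∈ ψ.clauses
      · have hne : emptyCount ψ.clauses ≠ 0 := emptyCount_ne_zero_iff.2 hE
        have hns : ¬ ψ.Satisfiable := fun hs => not_satisfiable_of_nil_mem hE ((kcnf_satisfiable_iff ψ).1 hs)
        rw [if_neg hne, if_neg hns, Nat.add_zero]
        rcases Nat.le_one_iff_eq_zero_or_eq_one.1 (accOf_le_one Ψ i) with h | h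
        · rw [h]; rfl
        · rw [h]; rfl
      · have hz : emptyCount ψ.clauses = 0 := by by_contra h; exact hE (emptyCount_ne_zero_iff.1 h)
        rw [if_pos hz]
        have hiff : (pres k n ψ.clauses).Satisfiable ↔ ψ.Satisfiable := by
          rw [satisfiable_pres_iff hE, kcnf_satisfiable_iff]
        by_cases hs : ψ.Satisfiable
        · rw [if_pos (hiff.2 hs), if_pos hs]
        · rw [if_neg (fun h => hs (hiff.1 h)), if_neg hs]
    · rw [hfr' 30 (by decide) (by decide) (by decide) (by decide), hreg 30 (by decide) (by decide) (by decide) (by decide),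
        hR' 30 (by decide), h30]
    · rw [hfr' 31 (by decide) (by decide) (by decide) (by decide), hreg 31 (by decide) (by decide) (by decide) (by decide),
        hR' 31 (by decide), h31]
    · rw [hfr' 32 (by decide) (by decide) (by decide) (by decide), hreg 32 (by decide) (by decide) (by decide) (by decide), h32']
    · -- below `Bv` nothing has changed
      intro a ha haB
      rw [hfr' a (by omega) (by omega) (by omega) (by omega),
        hfr a (by simp only [Foot, lay, not_or, not_and, not_lt]; change _ ∧ _ ∧ _ ∧ (Bv ≤ a → _) ∧ (Sv ≤ a → _); omega)]
      change merge R' D₁ a = Hf a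
      rw [merge_apply_of_le ha, hD₁, stampData_apply_of_not (by omega) (by omega), outMem_of_lt _ _ haB]
      split_ifs
      · rw [outMem_of_lt _ _ (by omega), hD a ha haB]
      · exact hD a ha haB
    · -- the stamps
      intro a ha
      rw [hfr' (Sv + a) (by omega) (by omega) (by omega) (by omega)]
      exact hinv.stamp a ha
    · -- every cell a word
      rw [merge_self]
      exact Exec.memLE (V := 2 ^ w - 1) (le_refl _) (by omega) hexp post_queryFree (cle_post (by omega)) hinv.memT

/-- The output string is nonempty iff there is a leaf. [folklore] -/
theorem encodeList_length_pos_iff (Ψ : List (KCNF kk)) : 0 < (KCNF.encodeList Ψ).length ↔ 0 < Ψ.length := by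
  cases Ψ with
  | nil => simp [KCNF.encodeList]
  | cons ψ Ψ => simp [KCNF.encodeList]

/-- The summed parser input over the leaves is the length of the output string. [folklore] -/
theorem sum_range_encode_length (Ψ : List (KCNF kk)) :
    ∀ N, N ≤ Ψ.length → (Finset.range N).sum (fun i => ((Ψ[i]?).map fun ψ => ψ.encode.length + 1).getD 0) = offOf Ψ N
  | 0, _ => by simp [offOf, KCNF.encodeList]
  | N + 1, hN => by
    rw [Finset.sum_range_succ, sum_range_encode_length Ψ N (by omega), offOf_succ Ψ (by omega),
      List.getElem?_eq_getElem (by omega)]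
    rfl

/-- **The invariant holds on entering the loop** (from the store left by the build phase). [folklore] -/
theorem loopInv_zero (Ψ : List (KCNF kk)) {Hf : ℕ → ℕ} {BOT κ n w : ℕ} (hκ : 0 < κ) (hw3 : 3 ≤ w)
    (hzero : ∀ a, 2 ^ (w - 1) ≤ a → Hf a = 0) (hle : ∀ a, Hf a ≤ 2 ^ w - 1)
    (hlt : BOT + κ * (KCNF.encodeList Ψ).length < 2 ^ (w - 1)) (hn : n < 2 ^ w) :
    LoopInv Ψ Hf BOT κ n (2 ^ (w - 1)) (2 ^ (w - 1) + 2 ^ (w - 2)) (2 ^ (w - 2)) w 0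
      ⟨merge (preRegs (BOT + κ * (KCNF.encodeList Ψ).length) BOT n (2 ^ (w - 1)) (2 ^ (w - 1) + 2 ^ (w - 2)) w) Hf, []⟩ := by
  have hw1 : 2 ^ (w - 1) < 2 ^ w := Nat.pow_lt_pow_right (by norm_num) (by omega)
  have hw2 : 2 ^ (w - 1) + 2 ^ (w - 2) < 2 ^ w := by
    have : 2 ^ (w - 2) + 2 ^ (w - 2) = 2 ^ (w - 1) := by rw [← two_mul, ← pow_succ']; congr 1; omega
    have : 2 ^ (w - 1) + 2 ^ (w - 1) = 2 ^ w := by rw [← two_mul, ← pow_succ']; congr 1; omega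
    have : 0 < 2 ^ (w - 2) := Nat.two_pow_pos _
    omega
  have hww : w < 2 ^ w := Nat.lt_two_pow_self
  refine ⟨rfl, _, Hf, rfl, ?_, rfl, ?_, rfl, by simp [preRegs, accOf_zero], rfl, rfl, rfl, fun a _ _ => rfl, fun a _ => ?_, fun a => ?_⟩
  · simp [preRegs, offOf, KCNF.encodeList]
  · have e : preRegs (BOT + κ * (KCNF.encodeList Ψ).length) BOT n (2 ^ (w - 1)) (2 ^ (w - 1) + 2 ^ (w - 2)) w 22 =
        if BOT < BOT + κ * (KCNF.encodeList Ψ).length then 1 else 0 := by simp [preRegs]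
    rw [e]
    have h := encodeList_length_pos_iff Ψ
    by_cases hN : 0 < Ψ.length
    · have h1 := Nat.mul_le_mul_left κ (h.2 hN)
      rw [if_pos hN, if_pos (show BOT < BOT + κ * (KCNF.encodeList Ψ).length by omega)]
    · have h0 : (KCNF.encodeList Ψ).length = 0 := by
        have := h.1; by_contra h2; exact hN (this (Nat.pos_of_ne_zero h2))
      simp [h0, hN]
  · exact (hzero _ (by omega)).le
  · unfold merge
    split_ifs with ha
    · simp only [preRegs]; split_ifs <;> omega
    · exact hle a

/-- **Leaving the loop** (the `hexit` clause): after the last leaf the flag is down and `fin` outputs the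
accumulated answer. [folklore] -/
theorem loop_exit (Ψ : List (KCNF kk)) {Hf : ℕ → ℕ} {BOT κ n Bv Sv QE w : ℕ} (st : Store)
    (h : LoopInv Ψ Hf BOT κ n Bv Sv QE w Ψ.length st) :
    st.mem 22 = 0 ∧ ∃ (st' : Store) (t' : ℕ), t' ≤ 2 ∧ Exec w noOracle fin st st' t' ∧
      readOut st'.mem = [if ∃ ψ ∈ Ψ, ψ.Satisfiable then 1 else 0] := by
  obtain ⟨hqs, R, D, hmem, -, -, h22, -, h25, -⟩ := h
  obtain ⟨stm, stq⟩ := st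
  simp only at hqs hmem
  subst hqs; subst hmem
  refine ⟨by change merge R D 22 = 0; rw [merge_apply_of_lt (by decide), h22, if_neg (lt_irrefl _)], ?_⟩
  obtain ⟨hex, hout⟩ := fin_exec (w := w) (O := noOracle) (merge R D) []
  refine ⟨_, 2, le_rfl, hex, ?_⟩
  rw [hout, merge_apply_of_lt (by decide), h25, accOf_length]

open scoped Classical in
/-- **The driver decides `φ`** within the stated number of steps: the build phase, `19` steps per
symbol of the sparsifier's output, a per-leaf overhead, and `cstep · nmax` per emulated run
(`cstep = 38`). The contracts: the machine `Mt` writes the string `KCNF.encodeList Ψ` of leaves `Ψ`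
(clause lists on the variables of `φ`, at most `Cs · n` pairwise distinct clauses each, `φ`
satisfiable iff some leaf is) within `T'` steps; the program `M` decides every `k`-CNF without repeated
clauses of density `max (Cs + 1) 2` on at most `n` variables within `nmax` steps at word size
`k' (numVars + inputWidth)`; the word size `W` holds every address and constant
(`cellAddr … < 2^(W-1)`, etc.). [cite: ImpagliazzoPaturiZaneJCSS2001, Cor. 1 and Cor. 2 (the SERF reduction, machine level)] -/
theorem driver_outputsWithin (Mt : TM2ComputableAux Γ' Γ') (k k' : ℕ) {M : Program} (hdet : M.IsDeterministic)
    (hof : M.IsOracleFree) {w Cs Cd nmax Y T' : ℕ} (φ : CNF ℕ) (hwid : φ.IsWidthLE k) (Ψ : List (KCNF k))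
    (hΨn : ∀ ψ ∈ Ψ, CNF.numVars ψ.clauses ≤ φ.numVars) (hΨc : ∀ ψ ∈ Ψ, ψ.clauses.length ≤ Cs * φ.numVars)
    (hΨnd : ∀ ψ ∈ Ψ, ψ.clauses.Nodup) (hΨeq : φ.Satisfiable ↔ ∃ ψ ∈ Ψ, ψ.Satisfiable)
    (hΨY : ∀ ψ ∈ Ψ, (KSatTranscoder.clauseWords ψ.clauses).length ≤ Y) (hCd : max (Cs + 1) 2 ≤ Cd)
    (hrun : Mt.OutputsWithin (KCNF.encode (toKCNF k φ hwid)) (KCNF.encodeList Ψ) T')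
    (hM : ∀ cs : CNF ℕ, cs.IsWidthLE k → cs.Nodup → CNF.numClauses cs ≤ Cd * CNF.numVars cs → CNF.numVars cs ≤ φ.numVars →
      ∃ (c : Cfg) (t : ℕ), t ≤ nmax ∧
        HaltsWithin M (k' * (CNF.numVars cs + inputWidth (encodeCNFWords cs))) noOracle zeroCoins (encodeCNFWords cs) t c ∧
        readOut c.mem = [if cs.Satisfiable then 1 else 0])
    (hw8 : 8 ≤ w) (hwI : inputWidth (encodeCNFWords φ) ≤ w) (hwL : 2 * (encodeCNFWords φ).length + 200 < 2 ^ w)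
    (hw : cellAddr (Qof Mt φ) (TM2Emu.enc Mt.tm).κ (TM2Emu.enc Mt.tm).κ
        (TM2Emu.heightBound Mt.tm ((icodes Mt).cnfCodes φ).length T') + (TM2Emu.enc Mt.tm).κ < 2 ^ (w - 1))
    (hγ : (TM2Emu.enc Mt.tm).γ + 1 < 2 ^ w) (hkey : TM2Emu.keyBound Mt.tm < 2 ^ w)
    (hnn : φ.numVars + φ.numVars < 2 ^ w) (hnw : φ.numVars + w < 2 ^ w) (hsz : Nat.size φ.numVars + 2 ≤ w)
    (hYw : Y + 9 < 2 ^ (w - 2)) (hN : Ψ.length + 1 < 2 ^ w)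
    (hws : ∀ ψ ∈ Ψ, k' * (CNF.numVars (pres k φ.numVars ψ.clauses) +
      inputWidth (encodeCNFWords (pres k φ.numVars ψ.clauses))) + 2 ≤ w)
    (hMc : Program.maxConst M < 2 ^ (w - 2)) (ρ : ℕ → ℕ) :
    OutputsWithin (driver Mt k k' M) w noOracle ρ (encodeCNFWords φ) [if φ.Satisfiable then 1 else 0]
      (preTime Mt φ T' + 4 * w + 19 * (KCNF.encodeList Ψ).length +
        Ψ.length * (7 * Y + 4 * w + 111 + cstep * nmax + 13) + 4) := by
  have hκ : 0 < (TM2Emu.enc Mt.tm).κ := (TM2Emu.enc_good Mt.tm).κ_pos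
  -- the build phase
  obtain ⟨Hf, t₀, hpre, ht₀, hstream, hzero, hle, hout, htop⟩ := pre_exec (w := w) Mt φ hwid hrun
    (by
      have := TM2Comp.length_le_of_outputsWithin Mt hrun
      simp only [List.length_map, TM2Emu.heightBound, cnfCodes_eq_map_inp Mt φ hwid, inp] at this ⊢
      rw [Nat.mul_comm]; exact this)
    (by omega) hwI hwL hw (by omega) hkey
  rw [List.length_map] at hstream hpre
  -- the symbols that occur are separated
  have hsep : (pcodes Mt).Sep (KCNF.encodeList Ψ) := fun γ hγm ξ hξ => by
    rw [pcodes_cd, pcodes_cd, codeO, codeO, TM2Emu.code_eq_code_iff Mt.tm (hout _ (List.mem_map.2 ⟨γ, hγm, rfl⟩))] at hξ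
    exact Mt.outputAlphabet.symm.injective hξ
  have hstream' : StreamAt Hf (BOTof Mt φ) (TM2Emu.enc Mt.tm).κ (KCNF.encodeList Ψ).length
      ((KCNF.encodeList Ψ).map (pcodes Mt).cd) := by
    have : (KCNF.encodeList Ψ).map (pcodes Mt).cd =
        ((KCNF.encodeList Ψ).map Mt.outputAlphabet.symm).map ((TM2Emu.enc Mt.tm).code Mt.tm.k₁) := by
      rw [List.map_map]; exact List.map_congr_left fun γ _ => (pcodes_cd Mt γ)
    rw [this]; simpa using hstream
  rw [List.length_map] at htop
  -- the loop
  have hmain := outputsWithin_withSubrunLoop_sum (W := w) (O := noOracle) ρ (pre := pre Mt) (body := leafBody (pcodes Mt)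
      (TM2Emu.enc Mt.tm).κ k k') (post := post) (fin := fin) (flag := 22) (L := lay) (VT := 2 ^ w - 1) (M := M)
    (x := encodeCNFWords φ) (out := [if φ.Satisfiable then 1 else 0]) (N := Ψ.length) (Tp := 11) (Tf := 2) (nmax := nmax)
    (leafTimeAt k φ.numVars w Ψ)
    (LoopInv Ψ Hf (BOTof Mt φ) (TM2Emu.enc Mt.tm).κ φ.numVars (2 ^ (w - 1)) (2 ^ (w - 1) + 2 ^ (w - 2)) (2 ^ (w - 2)) w)
    hwI hpre (loopInv_zero (n := φ.numVars) Ψ hκ (by omega) hzero hle htop (by omega)) (Nat.sub_add_cancel Nat.one_le_two_pow)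
    (by have : 2 ≤ 2 ^ w := by calc (2 : ℕ) = 2 ^ 1 := rfl
                                   _ ≤ 2 ^ w := Nat.pow_le_pow_right (by norm_num) (by omega)
        omega)
    (fun r hr => by
      simp only [lay, Layout.regs, List.mem_cons, List.not_mem_nil, or_false] at hr
      have : 64 ≤ 2 ^ w := by calc (64 : ℕ) = 2 ^ 6 := rfl
                               _ ≤ 2 ^ w := Nat.pow_le_pow_right (by norm_num) (by omega)
      omega)
    hdet hof
    (leaf_step Mt k k' Ψ hκ (by unfold BOTof Qof; omega) hstream' hsep htop hΨn hΨc hΨnd hCd hM hw8 hnn hnw hsz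
      (fun ψ hψ => by have := hΨY ψ hψ; omega) hN hws hMc hγ)
    (fun st hst => by
      obtain ⟨h1, st', t', ht', hex, hout'⟩ := loop_exit Ψ st hst
      refine ⟨h1, st', t', ht', hex, ?_⟩
      rw [hout']
      by_cases hs : φ.Satisfiable
      · rw [if_pos (hΨeq.1 hs), if_pos hs]
      · rw [if_neg (fun h => hs (hΨeq.2 h)), if_neg hs])
  refine hmain.mono ?_
  -- the time
  have hsum : (Finset.range Ψ.length).sum (leafTimeAt k φ.numVars w Ψ) ≤
      19 * (KCNF.encodeList Ψ).length + Ψ.length * (7 * Y + 4 * w + 111) := by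
    have h1 : ∀ i ∈ Finset.range Ψ.length, leafTimeAt k φ.numVars w Ψ i ≤
        19 * ((Ψ[i]?).map fun ψ => ψ.encode.length + 1).getD 0 + (7 * Y + 4 * w + 111) := fun i hi => by
      rw [Finset.mem_range] at hi
      unfold leafTimeAt
      rw [List.getElem?_eq_getElem hi]
      simp only [Option.map_some, Option.getD_some, leafTime]
      have hψ : Ψ[i] ∈ Ψ := List.getElem_mem hi
      have h2 := formulaTime_le Ψ[i]
      have h3 : (encodeCNFWords (pres k φ.numVars (Ψ[i]).clauses)).length ≤ Y + 5 := by
        have := hΨY _ hψ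
        by_cases hE : [] ∈ (Ψ[i]).clauses
        · rw [pres_of_mem hE]; simp [encodeCNFWords]
        · rw [pres_of_not_mem hE, KSatTranscoder.encodeCNFWords_eq, clauseWords_append]
          simp only [List.length_cons, List.length_append]
          split_ifs with h
          · rw [clauseWords_padClause _ (by omega)]; simp; omega
          · rw [show KSatTranscoder.clauseWords ([] : CNF ℕ) = [] from rfl]; simp; omega
      omega
    refine (Finset.sum_le_sum h1).trans ?_
    rw [Finset.sum_add_distrib, ← Finset.mul_sum, sum_range_encode_length Ψ Ψ.length le_rfl, offOf_length,
      Finset.sum_const, Finset.card_range, smul_eq_mul]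
  have : Ψ.length * (7 * Y + 4 * w + 111 + cstep * nmax + 13) =
      Ψ.length * (7 * Y + 4 * w + 111) + Ψ.length * (cstep * nmax + 11 + 2) := by ring
  omega

end main

end Literature.Computability.FineGrained.SerfRed
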